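import Mathlib
import Literature.Combinatorics.Enumerative.EntropyBregman

/-!
# The factorial product in Bugeaud–Laurent's `b`

In Y. Bugeaud, M. Laurent, J. Number Theory **61** (1996) 311–342, Théorème 1, the quantity
`b = ((R-1) b₂ + (S-1) b₁)/2 · (∏_{k=1}^{K-1} k!)^(-2/(K²-K))` enters hypothesis (2) through
`(K-1) log b`.  Laurent–Mignotte–Nesterenko (1995, Lemme 8) bound the factorial factor
asymptotically by `e^{3/2}/(K-1)`.  Here we prove, with no asymptotics, the slightly weaker but
fully explicit bound

  `(∏_{k<K} k!)^(-2/(K²-K)) ≤ exp(3/2 + log(K-1)/K) / (K-1)`   for every `K ≥ 2`,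

from `k! ≥ (k/e)^k` (`Literature…cast_mul_log_sub_le_log_factorial`) and `∑_{k≤n} k log k ≥ n²/2 · log n − n²/4`, together with
`log(K-1)/K ≤ log 50 / 51` for `K ≥ 51`.  These are the only analytic facts about `b` used in the
kernel derivation of the report's Theorem B from Bugeaud–Laurent's Théorème 1 (solo-ABC-informed,
paper §2.3).  Bookkeeping, recorded for the kernel.
-/

namespace Summit.ABC.ABC.Theorems

open Finset Real

/-- `n²/2 · log n − n²/4 ≤ ∑_{k ≤ n} k log k`. -/
theorem soloInformed_sum_mul_log_ge (n : ℕ) :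
    (n : ℝ) ^ 2 / 2 * Real.log n - (n : ℝ) ^ 2 / 4 ≤ ∑ k ∈ range (n + 1), (k : ℝ) * Real.log k := by
  induction n with
  | zero => simp
  | succ n ih =>
    rw [sum_range_succ]
    rcases Nat.eq_zero_or_pos n with hn | hn
    · subst hn
      simp
    have hnpos : (0 : ℝ) < n := by exact_mod_cast hn
    have hn1 : (0 : ℝ) < (n : ℝ) + 1 := by linarith
    -- log n ≥ log (n+1) - 1/n
    have hlog : Real.log ((n : ℝ) + 1) - 1 / n ≤ Real.log n := by
      have h := Real.log_le_sub_one_of_pos (show (0 : ℝ) < ((n : ℝ) + 1) / n by positivity)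
      rw [Real.log_div hn1.ne' hnpos.ne'] at h
      have : ((n : ℝ) + 1) / n - 1 = 1 / n := by field_simp; ring
      linarith
    have hlog1 : 0 ≤ Real.log ((n : ℝ) + 1) := Real.log_nonneg (by linarith)
    push_cast
    -- goal: (n+1)^2/2 log(n+1) - (n+1)^2/4 ≤ S_n + (n+1) log (n+1), with ih : n^2/2 log n - n^2/4 ≤ S_n
    have key : ((n : ℝ) + 1) ^ 2 / 2 * Real.log ((n : ℝ) + 1) - ((n : ℝ) + 1) ^ 2 / 4
        ≤ (n : ℝ) ^ 2 / 2 * Real.log n - (n : ℝ) ^ 2 / 4 + ((n : ℝ) + 1) * Real.log ((n : ℝ) + 1) := by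
      have h1 : (n : ℝ) ^ 2 / 2 * (Real.log ((n : ℝ) + 1) - 1 / n) ≤ (n : ℝ) ^ 2 / 2 * Real.log n :=
        mul_le_mul_of_nonneg_left hlog (by positivity)
      have h2 : (n : ℝ) ^ 2 / 2 * (1 / n) = n / 2 := by field_simp
      nlinarith [h1, h2, hlog1]
    linarith [key, ih]

/-- Lower bound for `∑_{k<K} log k!`, `K ≥ 1`. -/
theorem soloInformed_sum_log_factorial_ge (K : ℕ) (hK : 1 ≤ K) :
    ((K : ℝ) - 1) ^ 2 / 2 * Real.log ((K : ℝ) - 1) - ((K : ℝ) - 1) ^ 2 / 4 - (K : ℝ) * ((K : ℝ) - 1) / 2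
      ≤ ∑ k ∈ range K, Real.log (k.factorial : ℝ) := by
  obtain ⟨n, rfl⟩ : ∃ n, K = n + 1 := ⟨K - 1, by omega⟩
  have h1 : ∑ k ∈ range (n + 1), ((k : ℝ) * Real.log k - k) ≤ ∑ k ∈ range (n + 1), Real.log (k.factorial : ℝ) :=
    sum_le_sum fun k _ => Literature.Combinatorics.Enumerative.cast_mul_log_sub_le_log_factorial k
  rw [sum_sub_distrib] at h1
  have h2 := soloInformed_sum_mul_log_ge n
  have h3 : ∑ k ∈ range (n + 1), (k : ℝ) = (n : ℝ) * ((n : ℝ) + 1) / 2 := by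
    have h0 := Finset.sum_range_id_mul_two (n + 1)
    simp only [Nat.add_sub_cancel] at h0
    have h' : (((∑ k ∈ range (n + 1), k : ℕ)) : ℝ) * 2 = ((n : ℝ) + 1) * n := by exact_mod_cast h0
    push_cast at h'
    linarith
  push_cast
  have : ((n : ℝ) + 1 - 1) = n := by ring
  rw [this]
  linarith [h1, h2, h3]

/-- The factorial factor of Bugeaud–Laurent's `b`:
`(∏_{k<K} k!)^(-2/(K²-K)) ≤ exp(3/2 + log(K-1)/K)/(K-1)` for `K ≥ 2`. -/
theorem soloInformed_factorialProd_rpow_le (K : ℕ) (hK : 2 ≤ K) :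
    (∏ k ∈ range K, (k.factorial : ℝ)) ^ (-(2 : ℝ) / ((K : ℝ) ^ 2 - K))
      ≤ Real.exp (3 / 2 + Real.log ((K : ℝ) - 1) / K) / ((K : ℝ) - 1) := by
  have hKr : (2 : ℝ) ≤ K := by exact_mod_cast hK
  have hK1 : (0 : ℝ) < (K : ℝ) - 1 := by linarith
  have hKpos : (0 : ℝ) < K := by linarith
  have hP : (0 : ℝ) < ∏ k ∈ range K, (k.factorial : ℝ) :=
    prod_pos fun k _ => by exact_mod_cast Nat.factorial_pos k
  rw [Real.rpow_def_of_pos hP, Real.log_prod]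
  swap
  · intro k _; exact_mod_cast (Nat.factorial_pos k).ne'
  have hS := soloInformed_sum_log_factorial_ge K (by omega)
  -- x := -2/(K^2-K) < 0
  have hden : (0 : ℝ) < (K : ℝ) ^ 2 - K := by nlinarith
  have hx : -(2 : ℝ) / ((K : ℝ) ^ 2 - K) ≤ 0 := by
    apply div_nonpos_of_nonpos_of_nonneg (by norm_num) hden.le
  have h1 : (∑ k ∈ range K, Real.log (k.factorial : ℝ)) * (-(2 : ℝ) / ((K : ℝ) ^ 2 - K))
      ≤ (((K : ℝ) - 1) ^ 2 / 2 * Real.log ((K : ℝ) - 1) - ((K : ℝ) - 1) ^ 2 / 4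
          - (K : ℝ) * ((K : ℝ) - 1) / 2) * (-(2 : ℝ) / ((K : ℝ) ^ 2 - K)) :=
    mul_le_mul_of_nonpos_right hS hx
  have h2 : (((K : ℝ) - 1) ^ 2 / 2 * Real.log ((K : ℝ) - 1) - ((K : ℝ) - 1) ^ 2 / 4
          - (K : ℝ) * ((K : ℝ) - 1) / 2) * (-(2 : ℝ) / ((K : ℝ) ^ 2 - K))
      = -Real.log ((K : ℝ) - 1) + Real.log ((K : ℝ) - 1) / K + ((K : ℝ) - 1) / (2 * K) + 1 := by
    field_simp
    ring
  have h3 : ((K : ℝ) - 1) / (2 * K) ≤ 1 / 2 := by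
    rw [div_le_iff₀ (by positivity)]; linarith
  have h4 : (∑ k ∈ range K, Real.log (k.factorial : ℝ)) * (-(2 : ℝ) / ((K : ℝ) ^ 2 - K))
      ≤ (3 / 2 + Real.log ((K : ℝ) - 1) / K) + (-Real.log ((K : ℝ) - 1)) := by linarith
  calc Real.exp ((∑ k ∈ range K, Real.log (k.factorial : ℝ)) * (-(2 : ℝ) / ((K : ℝ) ^ 2 - K)))
      ≤ Real.exp ((3 / 2 + Real.log ((K : ℝ) - 1) / K) + (-Real.log ((K : ℝ) - 1))) :=
        Real.exp_le_exp.mpr h4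
    _ = Real.exp (3 / 2 + Real.log ((K : ℝ) - 1) / K) / ((K : ℝ) - 1) := by
        rw [Real.exp_add, Real.exp_neg, Real.exp_log hK1]; ring

/-- For `K ≥ 51`: `log(K-1)/K ≤ log 50 / 51` (concavity of `log` at `50`). -/
theorem soloInformed_log_pred_div_le (K : ℕ) (hK : 51 ≤ K) :
    Real.log ((K : ℝ) - 1) / K ≤ Real.log 50 / 51 := by
  have hKr : (51 : ℝ) ≤ K := by exact_mod_cast hK
  have hK1 : (0 : ℝ) < (K : ℝ) - 1 := by linarith
  -- log (K-1) ≤ log 50 + (K-1)/50 - 1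
  have h := Real.log_le_sub_one_of_pos (show (0 : ℝ) < ((K : ℝ) - 1) / 50 by positivity)
  rw [Real.log_div hK1.ne' (by norm_num)] at h
  -- log 50 ≥ 1.02 : since exp 1 < 2.72 ≤ 50^(1) ... use log 50 > 1 suffices? need log 50 ≥ 51/50.
  have hlog50 : (51 : ℝ) / 50 ≤ Real.log 50 := by
    rw [Real.le_log_iff_exp_le (by norm_num)]
    have h1 : Real.exp ((51 : ℝ) / 50) ≤ Real.exp 1 * Real.exp ((1 : ℝ) / 50) := by
      have : (51 : ℝ) / 50 = 1 + 1 / 50 := by norm_num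
      rw [this, Real.exp_add]
    have h2 : Real.exp ((1 : ℝ) / 50) ≤ 50 / 49 := by
      have h4 := Real.add_one_le_exp (-((1 : ℝ) / 50))
      rw [Real.exp_neg] at h4
      have h5 : 0 < Real.exp ((1 : ℝ) / 50) := Real.exp_pos _
      have h6 : (49 : ℝ) / 50 ≤ (Real.exp ((1 : ℝ) / 50))⁻¹ := by linarith
      have h7 : Real.exp ((1 : ℝ) / 50) * (49 / 50) ≤ 1 := by
        calc Real.exp ((1 : ℝ) / 50) * (49 / 50)
            ≤ Real.exp ((1 : ℝ) / 50) * (Real.exp ((1 : ℝ) / 50))⁻¹ :=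
              mul_le_mul_of_nonneg_left h6 h5.le
          _ = 1 := mul_inv_cancel₀ h5.ne'
      linarith
    have he := Real.exp_one_lt_d9
    calc Real.exp ((51 : ℝ) / 50) ≤ Real.exp 1 * Real.exp ((1 : ℝ) / 50) := h1
      _ ≤ 2.7182818286 * (50 / 49) := by
          apply mul_le_mul he.le h2 (Real.exp_pos _).le (by norm_num)
      _ ≤ 50 := by norm_num
  rw [div_le_div_iff₀ (by linarith) (by norm_num)]
  nlinarith [h, hlog50, hKr]

end Summit.ABC.ABC.Theorems
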